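import Literature.NumberTheory.CubicFields.DeloneFaddeevRing
import Mathlib.LinearAlgebra.Matrix.Basis
import Mathlib.LinearAlgebra.Matrix.Determinant.Basic
import Mathlib.LinearAlgebra.Matrix.NonsingularInverse
import HarnessLib

/-!
# The index form of a cubic ring and the injectivity of the Levi–Delone–Faddeev map on `GL₂(ℤ)`-orbits

Topic `Literature/NumberTheory/CubicFields`, continuing `DeloneFaddeevRing.lean` (the cubic ring
`R(f) = RingOfForm f` of an integral binary cubic form `f = (a, b, c, d)`, with `ℤ`-basis
`1, ω, θ` and table `ωθ = −ad`, `ω² = −ac + bω − aθ`, `θ² = −bd + dω − cθ`).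

Bhargava–Taniguchi–Thorne 2023, Thm 2.1 (Levi, Delone–Faddeev, Gan–Gross–Savin): "There is a
canonical, discriminant-preserving bijection between the set of `GL₂(ℤ)`-orbits on `V(ℤ)` and the
set of isomorphism classes of cubic rings." The inverse map (Gan–Gross–Savin §4,
Bhargava–Shankar–Tsimerman §2) sends a cubic ring `R` with a `ℤ`-basis `1, ω, θ` to the binary
cubic form read off from its multiplication table — the INDEX FORM of `(R, ⟨1, ω, θ⟩)`:
with `ωθ = n + ℓω + mθ`, `ω² = ∗ + pω + qθ`, `θ² = ∗ + rω + sθ` it is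
`f = (−q, p − 2m, 2ℓ − s, r)` (after the normalization `ω ↦ ω − m`, `θ ↦ θ − ℓ` this is the
familiar `ω² = −ac + bω − aθ`, `θ² = −bd + dω − cθ`), equivalently
`1 ∧ ξ ∧ ξ² = −f(x, y) · (1 ∧ ω ∧ θ)` for `ξ = xω + yθ`.
A change of the basis `(ω, θ)` of `R/ℤ` by `γ ∈ GL₂(ℤ)` (and of the lifts by integers) changes
`f` into `γ · f` for the twisted action `(γ · f)(u, v) = det(γ)⁻¹ f((u, v)γ)` of BTT (8). This
file proves exactly this, and deduces the injectivity of `f ↦ R(f)` on `GL₂(ℤ)`-orbits: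

* `indexForm b` — the index form of a commutative ring with a `ℤ`-basis `b : Fin 3 → R`
  (meant for `b 0 = 1`);
* `indexForm_basis` — the index form of `R(f)` on `(1, ω, θ)` is `f`;
* `indexForm_map` — invariance under ring isomorphisms (transport of the basis);
* `det_toMatrix_one_self_sq` — **`1 ∧ ξ ∧ ξ² = −f(x, y) · (1 ∧ b₁ ∧ b₂)`**: the determinant of the
  coordinates of `(1, ξ, ξ²)` is `−f(x, y)` for every `ξ = n + x b₁ + y b₂`;
* `indexForm_eq_twist_transition` — **change of basis = twisted action**: for two bases `b, b'`
  through `1` of the same ring, `indexForm b' = γ · indexForm b` with `γ ∈ GL₂(ℤ)` the matrix of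
  `(b'₁, b'₂)` on `(b₁, b₂)` modulo `ℤ·1` (`transition`, `isUnit_det_transition`);
* `GL2ZEquiv.of_ringEquiv` — **if `R(f) ≅ R(g)` as rings then `f` and `g` are
  `GL₂(ℤ)`-equivalent** (BTT Thm 2.1, injectivity of orbit ↦ ring).

With `DeloneFaddeevEquivariance.lean` (`GL₂(ℤ)`-equivalent forms give isomorphic rings) and
`DeloneFaddeevSurjective.lean` (every cubic ring is some `R(f)`) this completes the bijection of
Thm 2.1; NOT here: irreducible forms ↔ orders in cubic fields, `Stab(f) ≅ Aut(R)`.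

## References

* M. Bhargava, T. Taniguchi, F. Thorne, *Improved error estimates for the Davenport–Heilbronn
  theorems*, Math. Ann. 389 (2024) = arXiv:2107.12819, §2.2 (8) and Thm 2.1 [BhargavaTaniguchiThorne2023].
* M. Bhargava, A. Shankar, J. Tsimerman, *On the Davenport–Heilbronn theorems and second order
  terms*, Invent. Math. 193 (2013), §2 [BhargavaShankarTsimerman2012].
* W. T. Gan, B. Gross, G. Savin, *Fourier coefficients of modular forms on `G₂`*, Duke Math. J.
  115 (2002), §4, Prop. 4.2 [GanGrossSavin2002].

## Design

The index form is DEFINED by the explicit coefficients in the structure constants (so that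
`indexForm_basis` and `indexForm_map` are immediate), and the change-of-basis law is proved
through the invariant description `det [1, ξ, ξ²]_b = −f_b(x, y)` (`det_toMatrix_one_self_sq`,
with Mathlib's `Module.Basis.toMatrix`): determinants of coordinate matrices multiply along a change
of basis (`Module.Basis.toMatrix_mul_toMatrix`), the translation `ξ ↦ ξ + n` does not change
`1 ∧ ξ ∧ ξ²`, and an integral binary cubic form is determined by its values (`BinaryCubic.eq_of_eval_eq`).
-/

namespace Literature.NumberTheory.CubicFields

open Module

namespace BinaryCubic

/-- An integral binary cubic form is determined by its values (indeed by its values at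
`(1,0), (0,1), (1,1), (1,−1)`). [folklore] -/
theorem eq_of_eval_eq {f g : BinaryCubic ℤ} (h : ∀ u v : ℤ, f.eval u v = g.eval u v) : f = g := by
  have h10 := h 1 0
  have h01 := h 0 1
  have h11 := h 1 1
  have h1m := h 1 (-1)
  simp only [eval] at h10 h01 h11 h1m
  ext <;> linarith

end BinaryCubic

open BinaryCubic

section IndexForm

variable {R S : Type*} [CommRing R] [CommRing S]

/-- The INDEX FORM of a commutative ring `R` with a `ℤ`-basis `b = (b₀, b₁, b₂)` (meant for
`b₀ = 1`): writing `cᵢⱼₖ` for the `b`-coordinates of `bᵢ bⱼ`, it is the integral binary cubic form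
`(−c₁₁₂, c₁₁₁ − 2c₁₂₂, 2c₁₂₁ − c₂₂₂, c₂₂₁)` — the form `(a, b, c, d)` of the normalized table
`ω² = −ac + bω − aθ`, `θ² = −bd + dω − cθ`, `ωθ ∈ ℤ` after `ω ↦ ω − c₁₂₂`, `θ ↦ θ − c₁₂₁`
(Gan–Gross–Savin §4; Bhargava–Shankar–Tsimerman §2; the inverse of `f ↦ R(f)` in BTT 2023, Thm 2.1).
[cite: GanGrossSavin2002, §4 (the binary cubic form of a cubic ring with basis 1, ω, θ)] -/
noncomputable def indexForm (b : Basis (Fin 3) ℤ R) : BinaryCubic ℤ :=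
  ⟨-(b.repr (b 1 * b 1) 2),
    b.repr (b 1 * b 1) 1 - 2 * b.repr (b 1 * b 2) 2,
    2 * b.repr (b 1 * b 2) 1 - b.repr (b 2 * b 2) 2,
    b.repr (b 2 * b 2) 1⟩

/-- **The index form of `R(f)` on its basis `(1, ω, θ)` is `f`** (the two maps of BTT Thm 2.1 are
inverse to each other on this side). [cite: BhargavaShankarTsimerman2012, §2 (R(f) has multiplication table given by f)] -/
@[simp] theorem indexForm_basis (f : BinaryCubic ℤ) : indexForm (RingOfForm.basis f) = f := by
  ext <;> simp [indexForm]

/-- The coordinates of a product of transported basis vectors are the old structure constants. [folklore] -/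
theorem map_repr_mul (b : Basis (Fin 3) ℤ R) (φ : R ≃+* S) (i j : Fin 3) :
    (b.map φ.toAddEquiv.toIntLinearEquiv).repr
        (b.map φ.toAddEquiv.toIntLinearEquiv i * b.map φ.toAddEquiv.toIntLinearEquiv j) =
      b.repr (b i * b j) := by
  simp only [Basis.map_apply, AddEquiv.coe_toIntLinearEquiv]
  change (b.map φ.toAddEquiv.toIntLinearEquiv).repr (φ (b i) * φ (b j)) = _
  rw [← map_mul, Basis.map_repr, LinearEquiv.trans_apply]
  congr 1
  exact φ.symm_apply_apply (b i * b j)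

/-- **The index form is an isomorphism invariant**: transporting the basis along a ring
isomorphism `φ : R ≃+* S` does not change the index form. [folklore] -/
@[simp] theorem indexForm_map (b : Basis (Fin 3) ℤ R) (φ : R ≃+* S) :
    indexForm (b.map φ.toAddEquiv.toIntLinearEquiv) = indexForm b := by
  simp only [indexForm, map_repr_mul]

/-- Every element is `n·1 + x·b₁ + y·b₂` with `(n, x, y)` its coordinates, when `b₀ = 1`. [folklore] -/
theorem eq_repr_combination (b : Basis (Fin 3) ℤ R) (hb : b 0 = 1) (r : R) :
    r = (b.repr r 0 : R) + (b.repr r 1 : R) * b 1 + (b.repr r 2 : R) * b 2 := by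
  conv_lhs => rw [← b.sum_repr r]
  simp only [Fin.sum_univ_three, zsmul_eq_mul, hb, mul_one]

/-- Coordinates of `1` when `b₀ = 1`. [folklore] -/
theorem repr_one (b : Basis (Fin 3) ℤ R) (hb : b 0 = 1) : b.repr 1 = Finsupp.single 0 1 := by
  rw [← hb, b.repr_self]

/-- **`1 ∧ ξ ∧ ξ² = −f(x, y) · (1 ∧ b₁ ∧ b₂)`**: for a basis `b = (1, b₁, b₂)` and any
`ξ = n + x b₁ + y b₂`, the determinant of the `b`-coordinates of `(1, ξ, ξ²)` is `−f(x, y)` for the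
index form `f` (the invariant description of the index form; Gan–Gross–Savin §4). [cite: GanGrossSavin2002, §4 (index form as a determinant)] -/
theorem det_toMatrix_one_self_sq (b : Basis (Fin 3) ℤ R) (hb : b 0 = 1) (u : R) :
    (b.toMatrix ![1, u, u * u]).det = -((indexForm b).eval (b.repr u 1) (b.repr u 2)) := by
  set n := b.repr u 0 with hn
  set x := b.repr u 1 with hx
  set y := b.repr u 2 with hy
  have hu : u = (n : R) + (x : R) * b 1 + (y : R) * b 2 := eq_repr_combination b hb u
  have hsq : u * u = (n * n) • b 0 + (2 * n * x) • b 1 + (2 * n * y) • b 2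
      + (x * x) • (b 1 * b 1) + (2 * x * y) • (b 1 * b 2) + (y * y) • (b 2 * b 2) := by
    rw [hu, hb]
    simp only [zsmul_eq_mul]
    push_cast
    ring
  have hc : ∀ i, b.repr (u * u) i = n * n * (Finsupp.single (0 : Fin 3) (1 : ℤ) i)
      + 2 * n * x * (Finsupp.single (1 : Fin 3) (1 : ℤ) i) + 2 * n * y * (Finsupp.single (2 : Fin 3) (1 : ℤ) i)
      + x * x * b.repr (b 1 * b 1) i + 2 * x * y * b.repr (b 1 * b 2) i
      + y * y * b.repr (b 2 * b 2) i := by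
    intro i
    rw [hsq]
    simp only [map_add, map_zsmul, Basis.repr_self, Finsupp.add_apply, Finsupp.smul_apply,
      smul_eq_mul]
  have h1 : ∀ i, b.repr 1 i = Finsupp.single (0 : Fin 3) (1 : ℤ) i := fun i => by rw [repr_one b hb]
  rw [Matrix.det_fin_three]
  simp only [Basis.toMatrix_apply, Matrix.cons_val_zero, Matrix.cons_val_one, Matrix.cons_val_two,
    Matrix.head_cons, Matrix.tail_cons, h1, hc, ← hn, ← hx, ← hy]
  simp [indexForm, BinaryCubic.eval]
  ring

/-- The TRANSITION MATRIX of two bases `b, b'` through `1` of the same ring: the `(b₁, b₂)`-coordinates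
of `b'₁, b'₂` (row `i` = coordinates of `b'ᵢ₊₁`), i.e. the matrix of the induced change of basis of
`R/ℤ·1` — an element of `GL₂(ℤ)` (`isUnit_det_transition`). [folklore] -/
noncomputable def transition (b b' : Basis (Fin 3) ℤ R) : Matrix (Fin 2) (Fin 2) ℤ :=
  Matrix.of fun i j => b.repr (b' i.succ) j.succ

/-- Entries of the transition matrix. [folklore] -/
@[simp] theorem transition_apply (b b' : Basis (Fin 3) ℤ R) (i j : Fin 2) :
    transition b b' i j = b.repr (b' i.succ) j.succ := rfl

/-- The determinant of the full change-of-basis matrix is that of the transition matrix on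
`R/ℤ·1` (its first column is `(1, 0, 0)`). [folklore] -/
theorem det_toMatrix_eq_det_transition (b b' : Basis (Fin 3) ℤ R) (hb : b 0 = 1) (hb' : b' 0 = 1) :
    (b.toMatrix b').det = (transition b b').det := by
  have h1 : ∀ i, b.repr (b' 0) i = Finsupp.single (0 : Fin 3) (1 : ℤ) i := fun i => by
    rw [hb', repr_one b hb]
  rw [Matrix.det_fin_three, Matrix.det_fin_two]
  simp only [Basis.toMatrix_apply, h1, transition_apply, Fin.succ_zero_eq_one, Fin.succ_one_eq_two]
  simp
  ring

/-- The change-of-basis matrix between two bases is unimodular. [folklore] -/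
theorem isUnit_det_toMatrix (b b' : Basis (Fin 3) ℤ R) : IsUnit (b.toMatrix b').det :=
  Matrix.isUnit_det_of_right_inverse (b.toMatrix_mul_toMatrix_flip b')

/-- **The transition matrix lies in `GL₂(ℤ)`.** [folklore] -/
theorem isUnit_det_transition (b b' : Basis (Fin 3) ℤ R) (hb : b 0 = 1) (hb' : b' 0 = 1) :
    IsUnit (transition b b').det := by
  rw [← det_toMatrix_eq_det_transition b b' hb hb']
  exact isUnit_det_toMatrix b b'

/-- Determinants of coordinate matrices multiply along a change of basis. [folklore] -/
theorem det_toMatrix_eq_det_mul_det (b b' : Basis (Fin 3) ℤ R) (v : Fin 3 → R) :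
    (b.toMatrix v).det = (b.toMatrix b').det * (b'.toMatrix v).det := by
  rw [← Matrix.det_mul, Basis.toMatrix_mul_toMatrix]

/-- **Change of basis acts on the index form by the twisted `GL₂(ℤ)`-action** (BTT 2023, §2.2 (8):
`(γ · f)(u, v) = det(γ)⁻¹ f((u, v)γ)`): for two bases `b = (1, b₁, b₂)`, `b' = (1, b'₁, b'₂)` of the
same ring, `indexForm b' = γ · indexForm b` with `γ = transition b b' ∈ GL₂(ℤ)`. This is the
well-definedness of "cubic ring ↦ `GL₂(ℤ)`-orbit" in Thm 2.1. [cite: BhargavaTaniguchiThorne2023, §2.2 (8) and Theorem 2.1 (ring ↦ orbit well defined)] -/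
theorem indexForm_eq_twist_transition (b b' : Basis (Fin 3) ℤ R) (hb : b 0 = 1) (hb' : b' 0 = 1) :
    indexForm b' = twist (transition b b') (indexForm b) := by
  apply eq_of_eval_eq
  intro x y
  set γ := transition b b' with hγ
  -- the test element `ξ = x b'₁ + y b'₂`
  set ξ : R := (x : R) * b' 1 + (y : R) * b' 2 with hξ
  have hξ' : ξ = x • b' 1 + y • b' 2 := by rw [hξ, zsmul_eq_mul, zsmul_eq_mul]
  have hξ1 : b'.repr ξ 1 = x := by
    rw [hξ']
    simp only [map_add, map_zsmul, Basis.repr_self, Finsupp.add_apply, Finsupp.smul_apply, smul_eq_mul]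
    simp
  have hξ2 : b'.repr ξ 2 = y := by
    rw [hξ']
    simp only [map_add, map_zsmul, Basis.repr_self, Finsupp.add_apply, Finsupp.smul_apply, smul_eq_mul]
    simp
  have hb1 : b.repr ξ 1 = x * γ 0 0 + y * γ 1 0 := by
    rw [hξ']
    simp only [map_add, map_zsmul, Finsupp.add_apply, Finsupp.smul_apply, smul_eq_mul]
    simp [hγ, Fin.succ_zero_eq_one, Fin.succ_one_eq_two]
  have hb2 : b.repr ξ 2 = x * γ 0 1 + y * γ 1 1 := by
    rw [hξ']
    simp only [map_add, map_zsmul, Finsupp.add_apply, Finsupp.smul_apply, smul_eq_mul]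
    simp [hγ, Fin.succ_zero_eq_one, Fin.succ_one_eq_two]
  -- the two evaluations of `1 ∧ ξ ∧ ξ²`
  have h1 := det_toMatrix_one_self_sq b' hb' ξ
  rw [hξ1, hξ2] at h1
  have h2 := det_toMatrix_one_self_sq b hb ξ
  rw [hb1, hb2] at h2
  have h3 := det_toMatrix_eq_det_mul_det b b' ![1, ξ, ξ * ξ]
  have hP : (b.toMatrix b').det = γ.det := det_toMatrix_eq_det_transition b b' hb hb'
  rw [hP] at h3
  have hsq : γ.det * γ.det = 1 := Int.isUnit_mul_self (hP ▸ isUnit_det_toMatrix b b')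
  rw [eval_twist]
  linear_combination h1 - γ.det * h2 + γ.det * h3 + (b'.toMatrix ![1, ξ, ξ * ξ]).det * hsq

/-- The same with the bases the other way round: `indexForm b = γ' · indexForm b'`. [folklore] -/
theorem gl2zEquiv_indexForm (b b' : Basis (Fin 3) ℤ R) (hb : b 0 = 1) (hb' : b' 0 = 1) :
    GL2ZEquiv (indexForm b) (indexForm b') :=
  ⟨transition b b', isUnit_det_transition b b' hb hb', indexForm_eq_twist_transition b b' hb hb'⟩

end IndexForm

/-! ### Injectivity of `f ↦ R(f)` on `GL₂(ℤ)`-orbits -/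

/-- **Levi–Delone–Faddeev, injectivity** (BTT 2023, Thm 2.1): if the cubic rings `R(f)` and
`R(g)` of two integral binary cubic forms are isomorphic, then `f` and `g` are `GL₂(ℤ)`-equivalent
(for the twisted action (8)). Proof: transport the basis `(1, ω_f, θ_f)` along `φ : R(f) ≅ R(g)`;
its index form is still `f` (`indexForm_map`, `indexForm_basis`), while the index form of
`(1, ω_g, θ_g)` is `g`, and two bases through `1` of one ring have `GL₂(ℤ)`-equivalent index forms
(`indexForm_eq_twist_transition`). [cite: BhargavaTaniguchiThorne2023, Theorem 2.1 (isomorphic rings come from GL₂(ℤ)-equivalent forms)] -/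
theorem GL2ZEquiv.of_ringEquiv {f g : BinaryCubic ℤ} (φ : RingOfForm f ≃+* RingOfForm g) :
    GL2ZEquiv f g := by
  have h := gl2zEquiv_indexForm ((RingOfForm.basis f).map φ.toAddEquiv.toIntLinearEquiv)
    (RingOfForm.basis g) (by simp) (by simp)
  rwa [indexForm_map, indexForm_basis, indexForm_basis] at h

/-- Non-equivalent forms have non-isomorphic rings (contrapositive form used when counting
orbits by counting rings). [folklore] -/
theorem isEmpty_ringEquiv_of_not_gl2zEquiv {f g : BinaryCubic ℤ} (h : ¬ GL2ZEquiv f g) :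
    IsEmpty (RingOfForm f ≃+* RingOfForm g) :=
  ⟨fun φ => h (GL2ZEquiv.of_ringEquiv φ)⟩

end Literature.NumberTheory.CubicFields
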